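import Mathlib.Analysis.SpecialFunctions.OrdinaryHypergeometric
import Mathlib.Analysis.Analytic.ChangeOrigin
import Mathlib.Analysis.SpecialFunctions.Complex.Analytic
import Mathlib.Analysis.SpecialFunctions.Gamma.Basic
import Mathlib.Analysis.SpecialFunctions.Pow.Real
import HarnessLib

-- provenance: harness21/H21/H21/Prelude/Stoch/CardyFunction.lean @ cfecf1d (interim HEAD d8f2665); M5 mechanical rewrite
/-!
# Cardy's function (trunk `Stoch`, family `crit-perc`)

Cardy's function is the right-hand side of Cardy's crossing formula for critical percolation,
as a function of the cross-ratio `η ∈ [0,1]` of a conformal rectangle: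

`F(η) = (3 Γ(2/3) / Γ(1/3)²) · η^{1/3} · ₂F₁(1/3, 2/3; 4/3; η)`.

This prelude file is the **migration target** of the accepted definition
`Literature.Probability.Percolation.cardyFunction` (`H21/Statements/CritPerc/Wave0.lean:114`). The body of
`Literature.Probability.RandomPlanarGeometry.cardyFunction` below is character-for-character the body of Wave0's definition, so the two
are identified by `rfl` (the `rfl` lemma is stated in `H21/Statements/CritPerc/CardyFunction.lean`,
which imports both files). The sorry-free analyticity proof on `Set.Ioo 0 1` is copied from
Wave0 (we do NOT import a statements file into the prelude).

NOTE FOR SUPERVISOR: Wave0 should later `import Literature.Prelude.Stoch.CardyFunction` and delete its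
copies of `cardy_params_ne_neg_nat`, `cardyFunction`, `analyticOnNhd_rpow_one_third_Ioi`,
`analyticOnNhd_cardyFunction_Ioo`.

## Mathlib anchors used (not redefined)

* `ordinaryHypergeometric` (notation `₂F₁`), `ordinaryHypergeometricSeries`,
  `ordinaryHypergeometricSeries_radius_eq_one` (Mathlib.Analysis.SpecialFunctions.OrdinaryHypergeometric);
* `Real.Gamma`, `Real.rpow`.

Mathlib has no Gauss summation theorem (`₂F₁(a,b;c;1) = Γ(c)Γ(c-a-b)/(Γ(c-a)Γ(c-b))`) and no
hypergeometric ODE, so the endpoint value `F(1) = 1`, the symmetry `F(1-η) = 1 - F(η)`,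
monotonicity and the closed-form derivative are recorded as sorried theorems (all classical).

## Design notes

* `₂F₁` takes the junk value given by `tsum` outside the disc of convergence; at `η = 1` the
  series is (absolutely) summable since `c - a - b = 1/3 > 0`, so `cardyFunction 1` is the true
  value `1` (theorem `cardyFunction_one`, Gauss). For `η < 0` or `η > 1` the value of
  `cardyFunction` is junk (from `Real.rpow` and a divergent series) and no statement uses it.
* `cardyConst = 3 Γ(2/3) / Γ(1/3)²` is named separately; `cardyFunction` is NOT defined through
  it (to keep the `rfl` with Wave0) but `cardyFunction_eq_cardyConst_mul` is `rfl`.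
* The derivative `F'(η) = (Γ(2/3)/Γ(1/3)²) (η(1-η))^{-2/3}` is Cardy's eq. (8); equivalently
  `3 η^{1/3} ₂F₁(1/3,2/3;4/3;η) = B(η; 1/3, 1/3)` (incomplete beta function).

## References

* J. Cardy, *Critical percolation in finite geometries*, J. Phys. A 25 (1992) L201–L206,
  eqs. (8), (11).
* C. F. Gauss, *Disquisitiones generales circa seriem infinitam* (1812) (summation at `z = 1`).
* W. Werner, *Lectures on two-dimensional critical percolation*, IAS/Park City (2007), §3.
* summits/crit-perc-z2/SUMMIT.md.
-/

noncomputable section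

namespace Literature.Probability.RandomPlanarGeometry

open scoped Nat

section Analytic

/-- The parameters `(1/3, 2/3; 4/3)` of the hypergeometric factor in Cardy's formula are not
non-positive integers (elementary; needed to apply
`ordinaryHypergeometricSeries_radius_eq_one`; Cardy 1992). [cite: Cardy1992] -/
theorem cardy_params_ne_neg_nat (k : ℕ) :
    (k : ℝ) ≠ -(1 / 3 : ℝ) ∧ (k : ℝ) ≠ -(2 / 3 : ℝ) ∧ (k : ℝ) ≠ -(4 / 3 : ℝ) := by
  have hk : (0 : ℝ) ≤ k := k.cast_nonneg
  refine ⟨?_, ?_, ?_⟩ <;> intro h <;> linarith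

/-- The real power series `₂F₁(1/3, 2/3; 4/3; η)` appearing in Cardy's crossing formula has
radius of convergence `1` (Gauss 1812; specialisation of Mathlib's
`ordinaryHypergeometricSeries_radius_eq_one`). [cite: Gauss1812] -/
theorem ordinaryHypergeometricSeries_cardy_radius_eq_one :
    (ordinaryHypergeometricSeries ℝ (1 / 3 : ℝ) (2 / 3) (4 / 3)).radius = 1 :=
  ordinaryHypergeometricSeries_radius_eq_one ℝ _ _ _ cardy_params_ne_neg_nat

/-- If none of `a`, `b`, `c` is a non-positive integer, `z ↦ ₂F₁(a,b;c;z)` is given by the Gauss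
hypergeometric series on the open unit ball (Gauss 1812; immediate from Mathlib's
`ordinaryHypergeometricSeries_radius_eq_one`). [cite: Gauss1812] -/
theorem ordinaryHypergeometric_hasFPowerSeriesOnBall {𝕂 : Type*} {𝔸 : Type*} [RCLike 𝕂]
    [NormedDivisionRing 𝔸] [NormedAlgebra 𝕂 𝔸] [CompleteSpace 𝔸] (a b c : 𝕂)
    (habc : ∀ k : ℕ, (k : 𝕂) ≠ -a ∧ (k : 𝕂) ≠ -b ∧ (k : 𝕂) ≠ -c) :
    HasFPowerSeriesOnBall (₂F₁ a b c : 𝔸 → 𝔸) (ordinaryHypergeometricSeries 𝔸 a b c) 0 1 := by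
  have h := (ordinaryHypergeometricSeries 𝔸 a b c).hasFPowerSeriesOnBall
    (by rw [ordinaryHypergeometricSeries_radius_eq_one 𝔸 a b c habc]; exact one_pos)
  rwa [ordinaryHypergeometricSeries_radius_eq_one 𝔸 a b c habc] at h

/-- The function `η ↦ ₂F₁(1/3, 2/3; 4/3; η)` is real-analytic on the open interval `(0,1)`
(Gauss 1812; Cardy 1992). [cite: Gauss1812] -/
theorem analyticOnNhd_cardy_hypergeometric_Ioo :
    AnalyticOnNhd ℝ (₂F₁ (1 / 3 : ℝ) (2 / 3 : ℝ) (4 / 3 : ℝ) : ℝ → ℝ) (Set.Ioo 0 1) := by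
  refine (ordinaryHypergeometric_hasFPowerSeriesOnBall (𝔸 := ℝ) (1 / 3 : ℝ) (2 / 3) (4 / 3)
    cardy_params_ne_neg_nat).analyticOnNhd.mono ?_
  intro x hx
  rw [Metric.mem_eball, edist_zero_right, ← ofReal_norm, Real.norm_eq_abs,
    ENNReal.ofReal_lt_one]
  exact abs_lt.2 ⟨by linarith [hx.1], hx.2⟩

/-- The real cube root `η ↦ η^{1/3}` (as `Real.rpow`) is real-analytic on `(0, ∞)`
(elementary: `η^{1/3} = exp (log η / 3)` there). [folklore] -/
theorem analyticOnNhd_rpow_one_third_Ioi :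
    AnalyticOnNhd ℝ (fun η : ℝ => η ^ (1 / 3 : ℝ)) (Set.Ioi 0) := by
  intro x hx
  have h : (fun η : ℝ => Real.exp (Real.log η * (1 / 3 : ℝ))) =ᶠ[nhds x]
      fun η : ℝ => η ^ (1 / 3 : ℝ) := by
    filter_upwards [isOpen_Ioi.mem_nhds hx] with η hη
    exact (Real.rpow_def_of_pos hη _).symm
  refine AnalyticAt.congr ?_ h
  exact ((analyticAt_log hx).mul analyticAt_const).rexp

end Analytic

section Defs

/-- Cardy's constant `3 Γ(2/3) / Γ(1/3)²`, the normalising prefactor in Cardy's crossing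
formula making `F(1) = 1` (Cardy, J. Phys. A 25 (1992) L201, eq. (11)). [folklore] -/
def cardyConst : ℝ := 3 * Real.Gamma (2 / 3) / Real.Gamma (1 / 3) ^ 2

/-- Cardy's function, the right-hand side of Cardy's crossing formula (Cardy 1992, eq. (11);
summits/crit-perc-z2/SUMMIT.md):
`F(η) = (3 Γ(2/3) / Γ(1/3)²) · η^{1/3} · ₂F₁(1/3, 2/3; 4/3; η)` for a real cross-ratio `η`.
It is intended to be used for `η ∈ [0,1]`; outside `[0,1]` the value is whatever Mathlib's
`Real.rpow` and the (possibly divergent, hence junk-valued) series sum give. The body is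
character-for-character that of `Literature.Probability.Percolation.cardyFunction` (Wave0), so the two agree by `rfl`. [cite: Cardy1992, eq. (11] -/
def cardyFunction (η : ℝ) : ℝ :=
  3 * Real.Gamma (2 / 3) / Real.Gamma (1 / 3) ^ 2 * η ^ (1 / 3 : ℝ) *
    ₂F₁ (1 / 3 : ℝ) (2 / 3 : ℝ) (4 / 3 : ℝ) η

/-- Cardy's function factors as `cardyConst · η^{1/3} · ₂F₁(1/3,2/3;4/3;η)` (by definition;
Cardy 1992, eq. (11)). [cite: Cardy1992, eq. (11] -/
theorem cardyFunction_eq_cardyConst_mul (η : ℝ) :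
    cardyFunction η = cardyConst * η ^ (1 / 3 : ℝ) * ₂F₁ (1 / 3 : ℝ) (2 / 3 : ℝ) (4 / 3 : ℝ) η :=
  rfl

/-- `F(0) = 0`: Cardy's function vanishes at cross-ratio `0` (degenerate rectangle; Cardy 1992). [cite: Cardy1992] -/
@[simp]
theorem cardyFunction_zero : cardyFunction 0 = 0 := by
  simp [cardyFunction]

/-- Cardy's constant `3 Γ(2/3) / Γ(1/3)²` is positive (elementary, `Real.Gamma_pos_of_pos`). [folklore] -/
theorem cardyConst_pos : 0 < cardyConst := by
  unfold cardyConst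
  have h1 : 0 < Real.Gamma (2 / 3) := Real.Gamma_pos_of_pos (by norm_num)
  have h2 : 0 < Real.Gamma (1 / 3) := Real.Gamma_pos_of_pos (by norm_num)
  positivity

end Defs

section Regularity

/-- Since `₂F₁(1/3, 2/3; 4/3; ·)` has radius of convergence `1` and `η^{1/3}` is real-analytic
for `η > 0`, Cardy's function `F` is real-analytic on the open interval `(0,1)` (Cardy 1992,
Gauss 1812; proof copied from Wave0, crit-perc.S18). [cite: Cardy1992, Gauss 1812] -/
theorem analyticOnNhd_cardyFunction_Ioo : AnalyticOnNhd ℝ cardyFunction (Set.Ioo 0 1) := by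
  intro x hx
  have h1 : AnalyticAt ℝ (fun η : ℝ => η ^ (1 / 3 : ℝ)) x :=
    analyticOnNhd_rpow_one_third_Ioi x hx.1
  have h2 : AnalyticAt ℝ (₂F₁ (1 / 3 : ℝ) (2 / 3 : ℝ) (4 / 3 : ℝ) : ℝ → ℝ) x :=
    analyticOnNhd_cardy_hypergeometric_Ioo x hx
  exact (analyticAt_const.mul h1).mul h2

/-- Cardy's function is continuous on the open interval `(0,1)` (corollary of analyticity;
Cardy 1992). [cite: Cardy1992] -/
theorem continuousOn_cardyFunction_Ioo : ContinuousOn cardyFunction (Set.Ioo 0 1) :=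
  analyticOnNhd_cardyFunction_Ioo.continuousOn

/-- Cardy's function is differentiable on the open interval `(0,1)` (corollary of analyticity;
Cardy 1992). [cite: Cardy1992] -/
theorem differentiableOn_cardyFunction_Ioo : DifferentiableOn ℝ cardyFunction (Set.Ioo 0 1) :=
  analyticOnNhd_cardyFunction_Ioo.differentiableOn

end Regularity

section Endpoints

/-- The Gauss hypergeometric series `₂F₁(1/3, 2/3; 4/3; ·)` is summable at `η = 1`, since
`c - a - b = 4/3 - 1/3 - 2/3 = 1/3 > 0` (the terms are `O(n^{-4/3})`); hence the `tsum` defining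
`₂F₁ (1/3) (2/3) (4/3) (1 : ℝ)` is its true value (Gauss 1812; Werner 2007, §3). [cite: Gauss1812] -/
def summable_ordinaryHypergeometricSeries_cardy_one : Prop :=
  Summable fun n : ℕ =>
      ordinaryHypergeometricSeries ℝ (1 / 3 : ℝ) (2 / 3 : ℝ) (4 / 3 : ℝ) n fun _ => (1 : ℝ)

/-- `F(1) = 1`: by Gauss's summation theorem
`₂F₁(1/3, 2/3; 4/3; 1) = Γ(4/3) Γ(1/3) / (Γ(1) Γ(2/3)) = Γ(1/3)² / (3 Γ(2/3))`
(Gauss 1812; Cardy, J. Phys. A 25 (1992) L201, below eq. (11); Werner 2007, §3). [cite: Gauss1812] -/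
def cardyFunction_one : Prop :=
  cardyFunction 1 = 1

/-- Cardy's function is continuous on the closed interval `[0,1]` (continuity at `1` is Abel's
theorem for the summable series at `1`; Cardy 1992; Werner 2007, §3). [cite: Cardy1992] -/
def continuousOn_cardyFunction : Prop :=
  ContinuousOn cardyFunction (Set.Icc 0 1)

/-- Cardy's function is strictly increasing on `[0,1]` (its derivative
`(Γ(2/3)/Γ(1/3)²) (η(1-η))^{-2/3}` is positive on `(0,1)`; Cardy 1992, eq. (8)). [cite: Cardy1992, eq. (8] -/
def strictMonoOn_cardyFunction : Prop :=
  StrictMonoOn cardyFunction (Set.Icc 0 1)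

/-- Cardy's function maps `[0,1]` into `[0,1]` (it is a crossing probability: increasing from
`F(0) = 0` to `F(1) = 1`; Cardy 1992). [cite: Cardy1992] -/
def cardyFunction_mem_Icc : Prop :=
  ∀ {η : ℝ} (h : η ∈ Set.Icc (0 : ℝ) 1),
    cardyFunction η ∈ Set.Icc (0 : ℝ) 1

/-- The duality symmetry `F(1 - η) = 1 - F(η)` of Cardy's function on `[0,1]` (the derivative
`(η(1-η))^{-2/3}` is symmetric under `η ↦ 1 - η` and `F(0) + F(1) = 1`; Cardy 1992, discussion
after eq. (11); Werner 2007, §3). [cite: Cardy1992, discussion after eq. (11] -/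
def cardyFunction_one_sub : Prop :=
  ∀ {η : ℝ} (h : η ∈ Set.Icc (0 : ℝ) 1),
    cardyFunction (1 - η) = 1 - cardyFunction η

/-- Closed form of the derivative of Cardy's function on `(0,1)`:
`F'(η) = (Γ(2/3)/Γ(1/3)²) · (η(1-η))^{-2/3} = (cardyConst / 3) · (η(1-η))^{-2/3}`
(Cardy, J. Phys. A 25 (1992) L201, eq. (8); equivalently
`3 η^{1/3} ₂F₁(1/3,2/3;4/3;η) = B(η; 1/3, 1/3)`, the incomplete beta function). [cite: CardyJPhysA1992, eq. (8)] -/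
def hasDerivAt_cardyFunction : Prop :=
  ∀ {η : ℝ} (h : η ∈ Set.Ioo (0 : ℝ) 1),
    HasDerivAt cardyFunction (cardyConst / 3 * (η * (1 - η)) ^ (-(2 / 3 : ℝ))) η

end Endpoints

end Literature.Probability.RandomPlanarGeometry
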